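import Summits.AtomisticToContinuum.HydrodynamicLimit.Theorems.LocalSecondLaw.Negative.Functional
import Literature.Analysis.FluidPDE.HardSphereAlexander

/-!
# The `t = 0` law of large numbers is load-bearing in `LocalSecondLaw`

Negative knowledge for the crux `JParityClosure.LocalSecondLaw` (stmt-AtomisticToContinuum-13081), from the
standing disprover's `Cruxes/LocalSecondLaw/Disproof.lean` §(a).  `LocalSecondLawWithoutLLN` is the crux
VERBATIM with the single hypothesis `TendstoHydroFieldsAt (fun N => localGibbsLaw σ a₀ u₀ θ₀ N (Φ N)) Φ ρ u θ 0 →`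
deleted, and it is FALSE (`localSecondLaw_false_without_lln`, sorry-free): the Euler datum in the boundary term
`∫ H(ρ(0),θ(0)) φ(0)` then decouples from the particles; the homogeneous unit local Gibbs state, Alexander's
flows, the hot constant Euler state `(1, 0, Θ)` with `(3/2) log Θ = |f_ex(σ³)| + 4K + 3`, the test function
`φ(s,x) = ψ(s) = smoothTransition(1-2s)`, `τ = 1`, `η = δ = 1/2` give boundary term `≤ -4K-3`, functional
`≤ 1 + 4 ke` pathwise (`entropyFunctional_le`), and `ke ≤ K := |E∞| + 1` with local-Gibbs probability `≥ 3/4`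
eventually by the proved `t = 0` energy LLN (`localGibbs_lln_holds`) — so the event has probability
`≥ 3/4 > 1/2`.  Hence any proof of the crux must route the boundary term through the `t = 0` LLN; the Euler PDE
beyond its `t = 0` slice is not used by the statement at all.  refuter-cdisprove-stmt-AtomisticToContinuum-13081-0.
-/

noncomputable section

namespace Summit.AtomisticToContinuum.HydrodynamicLimit.Theorems.LocalSecondLawNegative

open MeasureTheory Filter Set Topology
open scoped ENNReal
open Literature.MathematicalPhysics.KineticTheory Literature.Analysis.FluidPDE

variable {N : ℕ}

/-! ## The frame: constant Euler states, the homogeneous local Gibbs state -/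

/-- Constant states `(1, 0, Θ)`, `Θ > 0`, are classical hard-sphere Euler solutions on every
`[0, T)` (all derivatives vanish). [folklore] -/
theorem constState_isSolution (σ T : ℝ) {Θ : ℝ} (hΘ : 0 < Θ) :
    IsHardSphereEulerSolution σ T (fun _ _ => 1) (fun _ _ => 0) (fun _ _ => Θ) := by
  have hg : ∀ x : T3, Literature.Analysis.FunctionSpaces.Torus.gradient
      (fun _ : T3 => hsPressure σ 1 Θ) x = 0 := fun x => by
    unfold Literature.Analysis.FunctionSpaces.Torus.gradient
      Literature.Analysis.FunctionSpaces.Torus.liftAt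
    simp [_root_.gradient]
  refine ⟨contDiffOn_const, contDiffOn_const, contDiffOn_const, fun _ _ _ => one_pos,
    fun _ _ _ => hΘ, ?_, ?_, ?_⟩ <;> intro t _ x <;>
    simp [Literature.Analysis.FunctionSpaces.Torus.timeDerivWithin,
      Literature.Analysis.FunctionSpaces.Torus.divergence,
      Literature.Analysis.FunctionSpaces.Torus.partialDeriv,
      Literature.Analysis.FunctionSpaces.Torus.lineDeriv, hg]

/-- The test profile `ψ(s) = smoothTransition (1 - 2s)`: smooth, `0 ≤ ψ ≤ 1`, `ψ 0 = 1`, `ψ = 0`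
on `[1/2, ∞)`, non-increasing. [folklore] -/
def psi (s : ℝ) : ℝ := Real.smoothTransition (1 - 2 * s)

/-- `ψ` is smooth. [folklore] -/
theorem psi_contDiff {n : ℕ∞} : ContDiff ℝ n psi :=
  Real.smoothTransition.contDiff.comp (contDiff_const.sub (contDiff_const.mul contDiff_id))

/-- `ψ` is non-increasing. [folklore] -/
theorem psi_antitone : Antitone psi := fun a b hab =>
  Real.smoothTransition.monotone (by linarith)

/-- `ψ 0 = 1`. [folklore] -/
theorem psi_zero : psi 0 = 1 := by simp [psi]

/-- `ψ = 0` on `[1/2, ∞)`. [folklore] -/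
theorem psi_eq_zero {s : ℝ} (hs : 1 / 2 ≤ s) : psi s = 0 :=
  Real.smoothTransition.zero_of_nonpos (by linarith)

/-- `ψ ≥ 0`. [folklore] -/
theorem psi_nonneg (s : ℝ) : 0 ≤ psi s := Real.smoothTransition.nonneg _

/-! ## (a) Load-bearing hypothesis: the `t = 0` law of large numbers

`LocalSecondLawWithoutLLN` is the crux VERBATIM with the single hypothesis
`TendstoHydroFieldsAt (fun N => localGibbsLaw σ a₀ u₀ θ₀ N (Φ N)) Φ ρ u θ 0 →` deleted: the Euler
datum `(ρ, u, θ)(0)` entering the boundary term `∫ H(ρ(0),θ(0)) φ(0)` is then decoupled from the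
particle system. -/

/-- The crux `LocalSecondLaw` VERBATIM with the `t = 0` law-of-large-numbers hypothesis
`TendstoHydroFieldsAt (fun N => localGibbsLaw σ a₀ u₀ θ₀ N (Φ N)) Φ ρ u θ 0 →` DELETED. -/
def LocalSecondLawWithoutLLN : Prop :=
  ∀ (a₀ θ₀ : Literature.MathematicalPhysics.KineticTheory.T3 → ℝ) (u₀ : Literature.MathematicalPhysics.KineticTheory.T3 → Literature.MathematicalPhysics.KineticTheory.V3), Continuous a₀ → Continuous θ₀ → Continuous u₀ → (∀ x, 0 < a₀ x) → (∀ x, 0 < θ₀ x) → ∃ σ₀ : ℝ, 0 < σ₀ ∧ ∀ σ : ℝ, 0 < σ → σ < σ₀ → ∀ (T : ℝ) (ρ θ : ℝ → Literature.MathematicalPhysics.KineticTheory.T3 → ℝ) (u : ℝ → Literature.MathematicalPhysics.KineticTheory.T3 → Literature.MathematicalPhysics.KineticTheory.V3), Literature.MathematicalPhysics.KineticTheory.IsHardSphereEulerSolution σ T ρ u θ → ∀ Φ : (N : ℕ) → Literature.Analysis.FluidPDE.HardSphereFlow (Literature.Analysis.FluidPDE.Torus.geometry (Fin 3)) (Literature.MathematicalPhysics.KineticTheory.hsDiameter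 σ N) (N + 1), 0 < T → ∀ τ : ℝ, 0 < τ → ∀ φ : ℝ → Literature.MathematicalPhysics.KineticTheory.T3 → ℝ, Literature.Analysis.FunctionSpaces.Torus.IsSmoothSpaceTimeOn Set.univ φ → (∀ s x, 0 ≤ φ s x) → (∃ τ' : ℝ, τ' < τ ∧ ∀ s, τ' ≤ s → ∀ x, φ s x = 0) → ∀ η δ : ℝ, 0 < η → 0 < δ → ∃ r₀ : ℝ, 0 < r₀ ∧ ∀ r : ℝ, 0 < r → r < r₀ → ∃ N₀ : ℕ, ∀ N : ℕ, N₀ ≤ N → let γ : Literature.Analysis.FluidPDE.Config (N + 1) (Fin 3) Literature.MathematicalPhysics.KineticTheory.T3 → ℝ → Literature.Analysis.FluidPDE.Config (N + 1) (Fin 3) Literature.MathematicalPhysics.KineticTheory.T3 := fun z s => (Φ N).flow s z; let bx : Literature.MathematicalPhysics.KineticTheory.T3 → Literature.MathematicalPhysics.KineticTheory.T3 → ℝ := fun x y => 3 / (Real.pi * r ^ 3) * max (1 - Literature.Analysis.FluidPDE.Torus.euclidDist x y / r) 0; let ρm : Literature.Analysis.FluidPDE.Config (N + 1) (Fin 3)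 Literature.MathematicalPhysics.KineticTheory.T3 → ℝ → Literature.MathematicalPhysics.KineticTheory.T3 → ℝ := fun z s x₀ => ∫ q, bx q.1 x₀ ∂(Literature.Analysis.FluidPDE.empiricalMeasure (γ z s)); let mm : Literature.Analysis.FluidPDE.Config (N + 1) (Fin 3) Literature.MathematicalPhysics.KineticTheory.T3 → ℝ → Literature.MathematicalPhysics.KineticTheory.T3 → Literature.MathematicalPhysics.KineticTheory.V3 := fun z s x₀ => ∫ q, bx q.1 x₀ • q.2 ∂(Literature.Analysis.FluidPDE.empiricalMeasure (γ z s)); let em : Literature.Analysis.FluidPDE.Config (N + 1) (Fin 3) Literature.MathematicalPhysics.KineticTheory.T3 → ℝ → Literature.MathematicalPhysics.KineticTheory.T3 → ℝ := fun z s x₀ => ∫ q, bx q.1 x₀ * (‖q.2‖ ^ 2 / 2) ∂(Literature.Analysis.FluidPDE.empiricalMeasure (γ z s)); let θm : Literature.Analysis.FluidPDE.Config (N + 1) (Fin 3) Literature.MathematicalPhysics.KineticTheory.T3 → ℝ → Literature.MathematicalPhysics.KineticTheory.T3 → ℝ := fun z s x₀ => 2 / 3 * (em z s x₀ / ρm z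 s x₀ - ‖mm z s x₀‖ ^ 2 / (2 * ρm z s x₀ ^ 2)); let Hs : ℝ → ℝ → ℝ := fun a b => if 0 < a ∧ 0 < b then -(a * (3 / 2 * Real.log b - Real.log a - Literature.MathematicalPhysics.KineticTheory.hsExcessFreeEnergy (a * σ ^ 3))) else 0; let I : Literature.Analysis.FluidPDE.Config (N + 1) (Fin 3) Literature.MathematicalPhysics.KineticTheory.T3 → ℝ := fun z => ∫ s in Set.Icc (0 : ℝ) τ, ∫ x : Literature.MathematicalPhysics.KineticTheory.T3, Hs (ρm z s x) (θm z s x) * (deriv (fun s' => φ s' x) s + ∑ k : Fin 3, (mm z s x) k / ρm z s x * Literature.Analysis.FunctionSpaces.Torus.partialDeriv k (φ s) x); Literature.MathematicalPhysics.KineticTheory.localGibbsLaw σ a₀ u₀ θ₀ N (Φ N) {z | I z + ∫ x : Literature.MathematicalPhysics.KineticTheory.T3, Hs (ρ 0 x) (θ 0 x) * φ 0 x < -η} ≤ ENNReal.ofReal δ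

/-- Continuity (hence measurability) of the mean kinetic energy. [folklore] -/
theorem continuous_ke : Continuous (ke : Config (N + 1) (Fin 3) T3 → ℝ) := by
  unfold ke
  fun_prop

/-- **`LocalSecondLaw` is false without its `t = 0` law of large numbers** (the hypothesis is
load-bearing: any proof must use it).  Witness: homogeneous unit local Gibbs data `(a₀,θ₀,u₀) =
(1,1,0)`, Alexander's flows, and the DECOUPLED constant Euler state `(1, 0, Θ)` with
`(3/2) log Θ = |f_ex(σ³)| + 4K + 3`, `K` one more than the limiting mean kinetic energy; test
function `φ(s,x) = ψ(s)` (`psi`), `τ = 1`, `η = δ = 1/2`.  The boundary term is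
`H(1,Θ) = f_ex(σ³) - (3/2) log Θ ≤ -4K - 3`, while pathwise `I(z) ≤ 1 + 4 ke(z)`
(`entropyFunctional_le`), and `ke ≤ K` with local-Gibbs probability `≥ 3/4` for large `N` by the
proved `t = 0` energy LLN (`localGibbs_lln_holds`); so the event has probability `≥ 3/4 > 1/2`.
[folklore] -/
theorem localSecondLaw_false_without_lln : ¬ LocalSecondLawWithoutLLN := by
  intro h
  have hc1 : Continuous (fun _ : T3 => (1 : ℝ)) := continuous_const
  have hc0 : Continuous (fun _ : T3 => (0 : V3)) := continuous_const
  obtain ⟨σ₀, hσ₀, h1⟩ := h (fun _ => 1) (fun _ => 1) (fun _ => 0) hc1 hc1 hc0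
    (fun _ => one_pos) (fun _ => one_pos)
  obtain ⟨σ₁, hσ₁, hL⟩ := localGibbs_lln_holds (fun _ => 1) (fun _ => 1) (fun _ => 0) hc1 hc1 hc0
    (fun _ => one_pos) (fun _ => one_pos)
  -- the reduced density
  obtain ⟨σ, hσpos, hσlt0, hσlt1, hσhalf⟩ : ∃ σ : ℝ, 0 < σ ∧ σ < σ₀ ∧ σ < σ₁ ∧ σ < 2⁻¹ := by
    refine ⟨min (min σ₀ σ₁) 2⁻¹ / 2, by positivity, ?_, ?_, ?_⟩ <;>
      linarith [min_le_left (min σ₀ σ₁) (2⁻¹ : ℝ), min_le_right (min σ₀ σ₁) (2⁻¹ : ℝ),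
        min_le_left σ₀ σ₁, min_le_right σ₀ σ₁, lt_min (lt_min hσ₀ hσ₁) (show (0 : ℝ) < 2⁻¹ by norm_num)]
  -- Alexander's flows
  let Φ : (N : ℕ) → HardSphereFlow (Torus.geometry (Fin 3)) (hsDiameter σ N) (N + 1) := fun N =>
    Classical.choice (HardSphereFlow.nonempty_torus_holds (d := Fin 3) (hsDiameter_pos hσpos N)
      (lt_of_le_of_lt (hsDiameter_le hσpos.le N) hσhalf) (N + 1))
  -- the t = 0 LLN of the homogeneous state (a TOOL here, not a hypothesis)
  obtain ⟨ρ₀, -, -, hLΦ⟩ := hL σ hσpos hσlt1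
  obtain ⟨hprob, hT⟩ := hLΦ Φ
  obtain ⟨Elim, hev⟩ : ∃ Elim : ℝ, Tendsto (fun N => localGibbsLaw σ (fun _ => 1) (fun _ => 0)
      (fun _ => 1) N (Φ N) {z | 1 < |empiricalEnergyField ((Φ N).flow 0 z) (fun _ => 1) - Elim|})
      atTop (𝓝 0) :=
    ⟨_, (hT (fun _ => 1) continuous_const 1 one_pos).2.2⟩
  set K : ℝ := |Elim| + 1 with hK
  have hKpos : 0 < K := by positivity
  -- the decoupled Euler temperature
  set L : ℝ := |hsExcessFreeEnergy (1 * σ ^ 3)| + 4 * K + 3 with hL'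
  set Θ : ℝ := Real.exp (2 / 3 * L) with hΘ
  have hΘpos : 0 < Θ := Real.exp_pos _
  have hlogΘ : 3 / 2 * Real.log Θ = L := by rw [hΘ, Real.log_exp]; ring
  have hsol := constState_isSolution σ 1 hΘpos
  -- the test function
  have hsmooth : Literature.Analysis.FunctionSpaces.Torus.IsSmoothSpaceTimeOn Set.univ
      (fun (s : ℝ) (_ : T3) => psi s) := by
    show ContDiffOn ℝ _ (fun p : ℝ × EuclideanSpace ℝ (Fin 3) => psi p.1) _
    exact (psi_contDiff.comp contDiff_fst).contDiffOn
  obtain ⟨r₀, hr₀, h3⟩ := h1 σ hσpos hσlt0 1 (fun _ _ => 1) (fun _ _ => Θ) (fun _ _ => 0) hsol Φ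
    one_pos 1 one_pos (fun s _ => psi s) hsmooth (fun s _ => psi_nonneg s)
    ⟨1 / 2, by norm_num, fun s hs _ => psi_eq_zero hs⟩ (1 / 2) (1 / 2) (by norm_num) (by norm_num)
  -- the mollification radius
  set r : ℝ := min (r₀ / 2) (1 / 4) with hr
  have hrpos : 0 < r := by positivity
  have hrlt : r < r₀ := lt_of_le_of_lt (min_le_left _ _) (by linarith)
  have hr2 : r < 1 / 2 := lt_of_le_of_lt (min_le_right _ _) (by norm_num)
  obtain ⟨N₀, h4⟩ := h3 r hrpos hrlt
  -- the LLN event is eventually small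
  obtain ⟨N₁, hN₁⟩ : ∃ N₁ : ℕ, ∀ N ≥ N₁, localGibbsLaw σ (fun _ => 1) (fun _ => 0) (fun _ => 1) N (Φ N)
      {z | 1 < |empiricalEnergyField ((Φ N).flow 0 z) (fun _ => 1) - Elim|} < 4⁻¹ :=
    Filter.eventually_atTop.1 (hev.eventually (gt_mem_nhds (by norm_num)))
  set N := max N₀ N₁ with hN
  have h5 := h4 N (le_max_left _ _)
  -- rewrite the event through the named functional
  change localGibbsLaw σ (fun _ => 1) (fun _ => 0) (fun _ => 1) N (Φ N)
      {z | entropyFunctional σ r 1 (fun s _ => psi s) (Φ N) z +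
        ∫ x : T3, Hs σ ((fun _ _ => (1 : ℝ)) 0 x) ((fun _ _ => Θ) 0 x) * (fun s _ => psi s) 0 x < -(1 / 2)}
      ≤ ENNReal.ofReal (1 / 2) at h5
  set LG := localGibbsLaw σ (fun _ => 1) (fun _ => 0) (fun _ => 1) N (Φ N) with hLGdef
  haveI : IsProbabilityMeasure LG := hprob N
  -- the boundary term
  have hHs : Hs σ 1 Θ = hsExcessFreeEnergy (1 * σ ^ 3) - L := by
    rw [← hlogΘ]
    unfold Hs
    rw [if_pos ⟨one_pos, hΘpos⟩, Real.log_one]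
    ring
  have hinit : (∫ x : T3, Hs σ ((fun _ _ => (1 : ℝ)) 0 x) ((fun _ _ => Θ) 0 x) *
      (fun (s : ℝ) (_ : T3) => psi s) 0 x) = hsExcessFreeEnergy (1 * σ ^ 3) - L := by
    show (∫ _ : T3, Hs σ 1 Θ * psi 0) = _
    rw [integral_const, psi_zero, mul_one, hHs]
    simp
  have hfabs : hsExcessFreeEnergy (1 * σ ^ 3) ≤ |hsExcessFreeEnergy (1 * σ ^ 3)| := le_abs_self _
  -- ψ regularity
  have hψd : Differentiable ℝ psi := (psi_contDiff (n := 1)).differentiable (by simp)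
  have hψc : Continuous (deriv psi) := (psi_contDiff (n := 1)).continuous_deriv (by simp)
  -- the sure sub-event
  set A : Set (Config (N + 1) (Fin 3) T3) := {z | z ∈ (Φ N).good ∧ ke z ≤ K} with hAdef
  have hAm : MeasurableSet A :=
    (Φ N).measurableSet_good.inter (measurableSet_le continuous_ke.measurable measurable_const)
  have hAE : A ⊆ {z | entropyFunctional σ r 1 (fun s _ => psi s) (Φ N) z +
      ∫ x : T3, Hs σ ((fun _ _ => (1 : ℝ)) 0 x) ((fun _ _ => Θ) 0 x) *
        (fun (s : ℝ) (_ : T3) => psi s) 0 x < -(1 / 2)} := by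
    intro z hz
    obtain ⟨hzg, hzK⟩ := hz
    rw [Set.mem_setOf_eq, hinit]
    have hI := entropyFunctional_le (σ := σ) hrpos hr2 (Φ N) hψd hψc psi_antitone hzg
    rw [psi_zero, psi_eq_zero (by norm_num : (1 : ℝ) / 2 ≤ 1), sub_zero, one_mul] at hI
    linarith
  -- its complement is small
  have hAc : Aᶜ ⊆ {z | 1 < |empiricalEnergyField ((Φ N).flow 0 z) (fun _ => 1) - Elim|} ∪
      ((Φ N).good)ᶜ := by
    intro z hz
    by_cases hzg : z ∈ (Φ N).good
    · left
      have hzK : K < ke z := by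
        by_contra hcon
        exact hz ⟨hzg, not_lt.1 hcon⟩
      rw [Set.mem_setOf_eq, (Φ N).flow_zero z hzg, empiricalEnergyField_eq_sum]
      have hke : ((N + 1 : ℕ) : ℝ)⁻¹ * ∑ i, (fun _ : T3 => (1 : ℝ)) (z i).1 * (‖(z i).2‖ ^ 2 / 2)
          = ke z := by
        simp [ke]
      rw [hke]
      have hE : Elim ≤ |Elim| := le_abs_self _
      exact lt_of_lt_of_le (by rw [hK] at hzK; linarith) (le_abs_self _)
    · right
      exact hzg
  have hg0 : LG ((Φ N).good)ᶜ = 0 := by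
    have hac : LG ≪ liouville (Torus.geometry (Fin 3)) (N + 1) (hsDiameter σ N) :=
      withDensity_absolutelyContinuous _ _
    exact hac (Φ N).measure_compl_good
  have hAc_lt : LG Aᶜ < 4⁻¹ :=
    calc LG Aᶜ ≤ LG ({z | 1 < |empiricalEnergyField ((Φ N).flow 0 z) (fun _ => 1) - Elim|} ∪
          ((Φ N).good)ᶜ) := measure_mono hAc
      _ ≤ LG {z | 1 < |empiricalEnergyField ((Φ N).flow 0 z) (fun _ => 1) - Elim|} +
          LG ((Φ N).good)ᶜ := measure_union_le _ _
      _ = LG {z | 1 < |empiricalEnergyField ((Φ N).flow 0 z) (fun _ => 1) - Elim|} := by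
          rw [hg0, add_zero]
      _ < 4⁻¹ := hN₁ N (le_max_right _ _)
  have hsumA : LG A + LG Aᶜ = 1 := prob_add_prob_compl hAm
  -- real arithmetic
  have h6 : LG A ≤ ENNReal.ofReal (1 / 2) := (measure_mono hAE).trans h5
  have h7 : (LG A).toReal ≤ 1 / 2 := ENNReal.toReal_le_of_le_ofReal (by norm_num) h6
  have h8 : (LG A).toReal + (LG Aᶜ).toReal = 1 := by
    rw [← ENNReal.toReal_add (measure_ne_top _ _) (measure_ne_top _ _), hsumA]
    simp
  have h9 : (LG Aᶜ).toReal < 1 / 4 := by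
    have := (ENNReal.toReal_lt_toReal (measure_ne_top _ _)
      (by norm_num : (4⁻¹ : ℝ≥0∞) ≠ ⊤)).2 hAc_lt
    rw [ENNReal.toReal_inv] at this
    norm_num at this
    linarith
  linarith


end Summit.AtomisticToContinuum.HydrodynamicLimit.Theorems.LocalSecondLawNegative

end
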